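import Literature.Geometry.Kaehler.AnalyticSetClosureDiff
import Literature.Geometry.Kaehler.LelongTheorem
import Mathlib.Analysis.Calculus.Deriv.Prod
import Mathlib.Analysis.Calculus.Deriv.Inv

/-!
# Deformation of an analytic set to its tangent cone: the limit cone is analytic of dimension `≤ p`

Let `A` be an analytic subset of the open set `Ω` of a finite-dimensional complex normed space
`V`, of pure dimension `p`, and `b ∈ Ω`. On the open set
`G = {(t, y) ∈ ℂ × V : b + t y ∈ Ω}` (`deformationDomain`) the **deformation space**
`X = {(t, y) ∈ G : b + t y ∈ A}` (`deformationSpace`) is analytic, as the preimage of `A` under the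
holomorphic map `(t, y) ↦ b + t y`; off the hyperplane `H = {t = 0}` (`deformationHyp`) it is the
family of dilations `{t} × (A − b)/t`, and the closure `𝒵 = cl (X ∖ H)` (`deformationClosure`) is
the analytic set of `AnalyticSetClosureDiff.lean`. Its central fibre
`F = {y ∈ V : (0, y) ∈ 𝒵}` (`limitCone A hb`) is the **limit cone** of `A` at `b`:

* `isAnalyticSet_limitCone`, `isClosed_limitCone` — `F` is a (closed) analytic subset of `V`;
* `smul_mem_limitCone` — `F` is a cone: `c • F ⊆ F` for `c ≠ 0` (the symmetry
  `(t, y) ↦ (t/c, c y)` of `X`);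
* `mem_limitCone_of_tendsto` — **`F` contains all limits of real blow-ups**: if `rₖ → 0⁺`,
  `yₖ → y` and `b + rₖ yₖ ∈ A`, then `y ∈ F` (so `F ⊇ Tan(A, b)`, the tangent cone of directions);
* `le_codim_limitCone` — **`dim F ≤ p`**: every regular point of `F` has codimension
  `≥ dim V − p` in `V`. Off `H` the regular points of `X` have codimension `dim V − p`
  (`le_codim_deformationSpace`, the slice `t = t₀` of `X` is `(A − b)/t₀`), so by
  `IsAnalyticSet.succ_le_codim_closure_diff_inter` the regular points of `𝒵 ∩ H = {0} × F` have
  codimension `≥ dim V − p + 1` in `G`, and `{0} × F` is regular of codimension `c + 1` where `F`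
  is regular of codimension `c` (`isRegPt_zero_prod`).

This is the "deformation to the tangent (normal) cone"; together with the structure of cones it
yields that the tangent cone of a pure `p`-dimensional analytic set is contained in an algebraic
cone of dimension `≤ p` ([Chirka1989, §8.2–8.3]; [Whitney1972, Ch. 7]), which is the set-theoretic
half of King's tangent cone theorem (`Literature.Geometry.Kaehler.King1971_tangentCone`,
[Harvey1977, Thm. 1.31]). Definitions + theorems; no named facts.

## References

* E. M. Chirka, *Complex Analytic Sets*, Kluwer 1989, §8.1–8.3 (tangent cones) [Chirka1989].
* H. Whitney, *Complex Analytic Varieties*, Addison-Wesley 1972, Ch. 7 (tangent cones `C₃`, `C₅`)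
  [Whitney1972].
* R. Harvey, *Holomorphic chains and their boundaries*, PSPUM XXX.1 (1977), §1.10 [Harvey1977].
-/

open scoped Manifold Topology ContDiff
open Set Filter Function TopologicalSpace

namespace Literature.Geometry.Kaehler

open SCV Literature.Analysis.Complex.SCV

variable {V : Type*} [NormedAddCommGroup V] [NormedSpace ℂ V]

/-! ### The deformation domain, map, space, hyperplane -/

section Defs

variable (Ω : Opens V) (b : V)

/-- The **deformation domain** `G = {(t, y) ∈ ℂ × V : b + t • y ∈ Ω}`, an open subset of `ℂ × V`
containing `{0} × V` when `b ∈ Ω`. [cite: Chirka1989, §8.1] -/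
def deformationDomain : Opens (ℂ × V) :=
  ⟨{z : ℂ × V | b + z.1 • z.2 ∈ (Ω : Set V)},
    Ω.isOpen.preimage (continuous_const.add (continuous_fst.smul continuous_snd))⟩

variable {Ω b}

/-- Membership in the deformation domain. [folklore] -/
@[simp] theorem mem_deformationDomain {z : ℂ × V} :
    z ∈ deformationDomain Ω b ↔ b + z.1 • z.2 ∈ (Ω : Set V) := Iff.rfl

/-- `(0, y) ∈ G` for every `y` when `b ∈ Ω`. [folklore] -/
theorem zero_mk_mem_deformationDomain (hb : b ∈ (Ω : Set V)) (y : V) :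
    ((0 : ℂ), y) ∈ deformationDomain Ω b := by
  simp [hb]

variable (Ω b) in
/-- The **deformation map** `m : G → Ω`, `(t, y) ↦ b + t y`. [cite: Chirka1989, §8.1] -/
def deformationMap (z : deformationDomain Ω b) : Ω := ⟨b + z.1.1 • z.1.2, z.2⟩

/-- The underlying map of the deformation map. [folklore] -/
@[simp] theorem coe_deformationMap (z : deformationDomain Ω b) :
    (deformationMap Ω b z : V) = b + z.1.1 • z.1.2 := rfl

/-- The deformation map is holomorphic. [folklore] -/
theorem contMDiff_deformationMap :
    ContMDiff 𝓘(ℂ, ℂ × V) 𝓘(ℂ, V) ∞ (deformationMap Ω b) := by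
  rw [← ContMDiff.subtypeVal_comp_iff]
  have h : ContDiff ℂ ∞ fun z : ℂ × V => b + z.1 • z.2 :=
    contDiff_const.add (contDiff_fst.smul contDiff_snd)
  exact h.contMDiff.comp contMDiff_subtype_val

/-- The deformation map is `MDifferentiable`. [folklore] -/
theorem mdifferentiable_deformationMap :
    MDifferentiable 𝓘(ℂ, ℂ × V) 𝓘(ℂ, V) (deformationMap Ω b) :=
  contMDiff_deformationMap.mdifferentiable (by simp)

/-- The **deformation space** `X = m⁻¹(A) = {(t, y) ∈ G : b + t y ∈ A}` of `A ⊆ Ω` at `b`.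
[cite: Chirka1989, §8.1] -/
def deformationSpace (A : Set Ω) (b : V) : Set (deformationDomain Ω b) :=
  deformationMap Ω b ⁻¹' A

/-- Membership in the deformation space. [folklore] -/
theorem mem_deformationSpace {A : Set Ω} {z : deformationDomain Ω b} :
    z ∈ deformationSpace A b ↔ deformationMap Ω b z ∈ A := Iff.rfl

variable (Ω b) in
/-- The **hyperplane** `H = {t = 0}` of the deformation domain. [folklore] -/
def deformationHyp : Set (deformationDomain Ω b) := {z | z.1.1 = 0}

/-- Membership in `H`. [folklore] -/
@[simp] theorem mem_deformationHyp {z : deformationDomain Ω b} : z ∈ deformationHyp Ω b ↔ z.1.1 = 0 :=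
  Iff.rfl

/-- The **closure `𝒵 = cl (X ∖ H)`** of the deformation space off the hyperplane: the total space
of the deformation of `A` to its tangent cone at `b`. [cite: Chirka1989, §8.1] -/
def deformationClosure (A : Set Ω) (b : V) : Set (deformationDomain Ω b) :=
  closure (deformationSpace A b \ deformationHyp Ω b)

/-- The embedding `y ↦ (0, y)` of `V` onto the central fibre of `G`. [folklore] -/
def centralEmbed (hb : b ∈ (Ω : Set V)) (y : V) : deformationDomain Ω b :=
  ⟨((0 : ℂ), y), zero_mk_mem_deformationDomain hb y⟩

/-- The underlying point of `centralEmbed`. [folklore] -/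
@[simp] theorem coe_centralEmbed (hb : b ∈ (Ω : Set V)) (y : V) :
    (centralEmbed hb y : ℂ × V) = ((0 : ℂ), y) := rfl

/-- The **limit cone** `F = {y : (0, y) ∈ cl (X ∖ H)}` of `A` at `b`: the central fibre of the
deformation to the tangent cone (Whitney's cone `C₃(A, b)` for the complex parameter).
[cite: Chirka1989, §8.1] -/
def limitCone (A : Set Ω) {b : V} (hb : b ∈ (Ω : Set V)) : Set V :=
  centralEmbed hb ⁻¹' deformationClosure A b

/-- Membership in the limit cone. [folklore] -/
theorem mem_limitCone {A : Set Ω} {hb : b ∈ (Ω : Set V)} {y : V} :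
    y ∈ limitCone A hb ↔ centralEmbed hb y ∈ deformationClosure A b := Iff.rfl

end Defs

/-! ### Analyticity -/

section Analytic

variable {Ω : Opens V} {b : V} {A : Set Ω}

/-- The deformation space of an analytic set is analytic (preimage under the holomorphic
deformation map). [cite: Chirka1989, §8.1] -/
theorem isAnalyticSet_deformationSpace (hA : IsAnalyticSet 𝓘(ℂ, V) A) (b : V) :
    IsAnalyticSet 𝓘(ℂ, ℂ × V) (deformationSpace A b) :=
  hA.preimage mdifferentiable_deformationMap

/-- The hyperplane `H = {t = 0}` is analytic. [folklore] -/
theorem isAnalyticSet_deformationHyp (Ω : Opens V) (b : V) :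
    IsAnalyticSet 𝓘(ℂ, ℂ × V) (deformationHyp Ω b) := by
  have hc : ContMDiff 𝓘(ℂ, ℂ × V) 𝓘(ℂ, Fin 1 → ℂ) ∞
      (fun z : deformationDomain Ω b => fun _ : Fin 1 => z.1.1) := by
    have h : ContDiff ℂ ∞ fun z : ℂ × V => fun _ : Fin 1 => z.1 :=
      contDiff_pi.2 fun _ => contDiff_fst
    exact h.contMDiff.comp contMDiff_subtype_val
  have h := isAnalyticSet_preimage_singleton_zero (I := 𝓘(ℂ, ℂ × V)) (hc.mdifferentiable (by simp))
  have heq : (fun z : deformationDomain Ω b => fun _ : Fin 1 => z.1.1) ⁻¹' {0} = deformationHyp Ω b := by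
    ext z
    simp only [mem_preimage, mem_singleton_iff, mem_deformationHyp, funext_iff, Pi.zero_apply,
      forall_const]
  rwa [heq] at h

variable [FiniteDimensional ℂ V]

/-- **`cl (X ∖ H)` is analytic** (`IsAnalyticSet.isAnalyticSet_closure_diff`). [cite: Chirka1989, §8.1] -/
theorem isAnalyticSet_deformationClosure (hA : IsAnalyticSet 𝓘(ℂ, V) A) (b : V) :
    IsAnalyticSet 𝓘(ℂ, ℂ × V) (deformationClosure A b) :=
  (isAnalyticSet_deformationSpace hA b).isAnalyticSet_closure_diff (isAnalyticSet_deformationHyp Ω b)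

omit [FiniteDimensional ℂ V] in
/-- The central embedding is holomorphic. [folklore] -/
theorem contMDiff_centralEmbed (hb : b ∈ (Ω : Set V)) :
    ContMDiff 𝓘(ℂ, V) 𝓘(ℂ, ℂ × V) ∞ (centralEmbed (Ω := Ω) hb) := by
  rw [← ContMDiff.subtypeVal_comp_iff]
  have h : ContDiff ℂ ∞ fun y : V => (((0 : ℂ), y) : ℂ × V) := contDiff_const.prodMk contDiff_id
  exact h.contMDiff

/-- **The limit cone is an analytic subset of `V`.** [cite: Chirka1989, §8.3 Lemma 1] -/
theorem isAnalyticSet_limitCone (hA : IsAnalyticSet 𝓘(ℂ, V) A) (hb : b ∈ (Ω : Set V)) :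
    IsAnalyticSet 𝓘(ℂ, V) (limitCone A hb) :=
  (isAnalyticSet_deformationClosure hA b).preimage ((contMDiff_centralEmbed hb).mdifferentiable (by simp))

omit [FiniteDimensional ℂ V] in
/-- The limit cone is closed. [folklore] -/
theorem isClosed_limitCone (A : Set Ω) (hb : b ∈ (Ω : Set V)) : IsClosed (limitCone A hb) :=
  isClosed_closure.preimage (Continuous.subtype_mk (continuous_const.prodMk continuous_id) _)

end Analytic

/-! ### The limit cone contains the limits of real blow-ups -/

section Limits

variable {Ω : Opens V} {b : V} {A : Set Ω}

/-- **Limits of blow-up directions lie in the limit cone**: if `rₖ > 0`, `rₖ → 0`, `yₖ → y` and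
`b + rₖ yₖ ∈ A` for all `k`, then `y ∈ limitCone A hb`. [cite: Chirka1989, §8.1 Prop. 1] -/
theorem mem_limitCone_of_tendsto (hb : b ∈ (Ω : Set V)) {r : ℕ → ℝ} (hr : ∀ k, 0 < r k)
    (hr0 : Tendsto r atTop (𝓝 0)) {ys : ℕ → V} {y : V} (hys : Tendsto ys atTop (𝓝 y))
    (hA : ∀ k, b + (r k : ℂ) • ys k ∈ ((↑) : Ω → V) '' A) : y ∈ limitCone A hb := by
  rw [mem_limitCone, deformationClosure, mem_closure_iff_seq_limit]
  have hmem : ∀ k, (((r k : ℂ)), ys k) ∈ deformationDomain Ω b := fun k => by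
    obtain ⟨a, -, ha⟩ := hA k
    rw [mem_deformationDomain, ← ha]; exact a.2
  refine ⟨fun k => ⟨_, hmem k⟩, fun k => ⟨?_, ?_⟩, ?_⟩
  · obtain ⟨a, haA, ha⟩ := hA k
    rw [mem_deformationSpace]
    convert haA using 1
    exact Subtype.ext ha.symm
  · rw [mem_deformationHyp]
    change ((r k : ℂ)) ≠ 0
    exact_mod_cast (hr k).ne'
  · rw [Topology.IsEmbedding.subtypeVal.tendsto_nhds_iff]
    change Tendsto (fun k => (((r k : ℂ)), ys k)) atTop (𝓝 ((0 : ℂ), y))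
    refine Tendsto.prodMk_nhds ?_ hys
    have := (Complex.continuous_ofReal.tendsto 0).comp hr0
    rw [Complex.ofReal_zero] at this
    exact this

end Limits

/-! ### The limit cone is a cone -/

section Cone

variable {Ω : Opens V} {b : V} {A : Set Ω}

/-- The symmetry `(t, y) ↦ (t / c, c • y)` of the deformation domain (`c ≠ 0`). [folklore] -/
noncomputable def deformationDilate (c : ℂ) (hc : c ≠ 0) (z : deformationDomain Ω b) : deformationDomain Ω b :=
  ⟨(z.1.1 / c, c • z.1.2), by
    have hz := z.2
    rw [mem_deformationDomain] at hz ⊢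
    simpa [smul_smul, div_mul_cancel₀ _ hc] using hz⟩

/-- The symmetry is continuous. [folklore] -/
theorem continuous_deformationDilate (c : ℂ) (hc : c ≠ 0) :
    Continuous (deformationDilate (Ω := Ω) (b := b) c hc) :=
  Continuous.subtype_mk (((continuous_fst.comp continuous_subtype_val).div_const c).prodMk
    ((continuous_snd.comp continuous_subtype_val).const_smul c)) _

/-- The symmetry preserves `X ∖ H`. [folklore] -/
theorem deformationDilate_mem_diff {c : ℂ} (hc : c ≠ 0) {z : deformationDomain Ω b}
    (hz : z ∈ deformationSpace A b \ deformationHyp Ω b) :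
    deformationDilate c hc z ∈ deformationSpace A b \ deformationHyp Ω b := by
  refine ⟨?_, ?_⟩
  · have h1 := hz.1
    rw [mem_deformationSpace] at h1 ⊢
    convert h1 using 1
    apply Subtype.ext
    simp [deformationDilate, smul_smul, div_mul_cancel₀ _ hc]
  · have h2 := hz.2
    rw [mem_deformationHyp] at h2 ⊢
    simpa [deformationDilate, hc] using h2

/-- **The limit cone is a cone**: `c • y ∈ F` for `y ∈ F` and `c ≠ 0`. [cite: Chirka1989, §8.1] -/
theorem smul_mem_limitCone {hb : b ∈ (Ω : Set V)} {y : V} (hy : y ∈ limitCone A hb) {c : ℂ}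
    (hc : c ≠ 0) : c • y ∈ limitCone A hb := by
  rw [mem_limitCone, deformationClosure] at hy ⊢
  have himage := image_closure_subset_closure_image (continuous_deformationDilate (Ω := Ω) (b := b) c hc)
    (s := deformationSpace A b \ deformationHyp Ω b) ⟨_, hy, rfl⟩
  have heq : deformationDilate c hc (centralEmbed hb y) = centralEmbed (Ω := Ω) hb (c • y) := by
    apply Subtype.ext
    simp [deformationDilate]
  rw [heq] at himage
  exact closure_mono (image_subset_iff.2 fun z hz => deformationDilate_mem_diff hc hz) himage

end Cone

/-! ### Regular points of `X` off `H` have codimension `dim V − p` -/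

section Codim

variable [FiniteDimensional ℂ V] {Ω : Opens V} {b : V} {A : Set Ω}

omit [FiniteDimensional ℂ V] in
/-- The image of the deformation space in `ℂ × V`. [folklore] -/
theorem image_coe_deformationSpace (A : Set Ω) (b : V) :
    ((↑) : deformationDomain Ω b → ℂ × V) '' deformationSpace A b =
      {z : ℂ × V | b + z.1 • z.2 ∈ ((↑) : Ω → V) '' A} := by
  ext z
  constructor
  · rintro ⟨w, hw, rfl⟩
    exact ⟨_, hw, rfl⟩
  · rintro ⟨a, haA, ha⟩
    have hz : z ∈ deformationDomain Ω b := by rw [mem_deformationDomain, ← ha]; exact a.2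
    refine ⟨⟨z, hz⟩, ?_, rfl⟩
    rw [mem_deformationSpace]
    convert haA using 1
    exact Subtype.ext ha.symm

omit [FiniteDimensional ℂ V] in
/-- **Slicing the deformation space at `t = t₀ ≠ 0`.** If `(t₀, y₀)` (with `t₀ ≠ 0`) is a regular
point of codimension `c` of (the image in `ℂ × V` of) the deformation space, then `b + t₀ y₀` is a
regular point of codimension `c` of (the image in `V` of) `A`: compose the defining submersion `g`
with `θ(x) = (t₀, (x − b)/t₀)`; `Dg` kills the velocity `(1, −y₀/t₀)` of the curve
`t ↦ (t, (x₀ − b)/t) ⊆ X`, so `Dg ∘ Dθ` is still onto. [cite: Chirka1989, §8.1] -/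
theorem isRegPt_of_isRegPt_image_deformationSpace {c : ℕ} {t₀ : ℂ} (ht₀ : t₀ ≠ 0) {y₀ : V}
    (hmem : (t₀, y₀) ∈ ((↑) : deformationDomain Ω b → ℂ × V) '' deformationSpace A b)
    (h : IsRegPt (((↑) : deformationDomain Ω b → ℂ × V) '' deformationSpace A b) c (t₀, y₀)) :
    IsRegPt (((↑) : Ω → V) '' A) c (b + t₀ • y₀) := by
  rw [image_coe_deformationSpace] at hmem h
  set X₀ : Set (ℂ × V) := {z : ℂ × V | b + z.1 • z.2 ∈ ((↑) : Ω → V) '' A} with hX₀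
  set A₀ : Set V := ((↑) : Ω → V) '' A with hA₀
  set x₀ : V := b + t₀ • y₀ with hx₀
  obtain ⟨U, hU, hzU, g, hg, hXU, hsurj⟩ := h
  -- the affine map `θ x = (t₀, t₀⁻¹ (x - b))` with `θ x₀ = (t₀, y₀)`
  set θ : V → ℂ × V := fun x => (t₀, t₀⁻¹ • (x - b)) with hθ
  have hθx₀ : θ x₀ = (t₀, y₀) := by
    simp [hθ, hx₀, smul_smul, inv_mul_cancel₀ ht₀]
  have hθc : ContDiff ℂ ∞ θ := contDiff_const.prodMk ((contDiff_id.sub contDiff_const).const_smul _)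
  have hθd : ∀ x, HasFDerivAt θ ((0 : V →L[ℂ] ℂ).prod (t₀⁻¹ • ContinuousLinearMap.id ℂ V)) x := by
    intro x
    refine (hasFDerivAt_const t₀ x).prodMk ?_
    have h1 : HasFDerivAt (fun x : V => x - b) (ContinuousLinearMap.id ℂ V) x :=
      (hasFDerivAt_id x).sub_const b
    exact h1.fun_const_smul t₀⁻¹
  have hmemθ : ∀ x, x ∈ A₀ ↔ θ x ∈ X₀ := by
    intro x
    simp [hθ, hX₀, hA₀, smul_smul, mul_inv_cancel₀ ht₀]
  refine ⟨θ ⁻¹' U, hU.preimage hθc.continuous, by rw [mem_preimage, hθx₀]; exact hzU, g ∘ θ,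
    hg.comp (hθc.differentiable (by simp)).differentiableOn (mapsTo_preimage θ U), ?_, ?_⟩
  · ext x
    constructor
    · rintro ⟨hxA, hxU⟩
      have : θ x ∈ X₀ ∩ U := ⟨(hmemθ x).1 hxA, hxU⟩
      rw [hXU] at this
      exact ⟨hxU, this.2⟩
    · rintro ⟨hxU, hgx⟩
      have : θ x ∈ U ∩ g ⁻¹' {0} := ⟨hxU, hgx⟩
      rw [← hXU] at this
      exact ⟨(hmemθ x).2 this.1, hxU⟩
  · -- the differential: `D(g ∘ θ)(x₀) = Dg(t₀, y₀) ∘ (0, t₀⁻¹ id)`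
    have hgd : DifferentiableAt ℂ g (t₀, y₀) := hg.differentiableAt (hU.mem_nhds hzU)
    have hgd' : DifferentiableAt ℂ g (θ x₀) := by rw [hθx₀]; exact hgd
    have hcomp : fderiv ℂ (g ∘ θ) x₀ =
        (fderiv ℂ g (t₀, y₀)).comp ((0 : V →L[ℂ] ℂ).prod (t₀⁻¹ • ContinuousLinearMap.id ℂ V)) := by
      rw [← hθx₀]
      exact (hgd'.hasFDerivAt.comp x₀ (hθd x₀)).fderiv
    rw [hcomp]
    set L := fderiv ℂ g (t₀, y₀) with hL
    -- `L` kills `(1, -t₀⁻¹ y₀)`: the curve `t ↦ (t, t⁻¹ (x₀ - b))` lies in `X₀`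
    have hkill : L ((1 : ℂ), -(t₀⁻¹ • y₀)) = 0 := by
      set γ : ℂ → ℂ × V := fun t => (t, t⁻¹ • (x₀ - b)) with hγ
      have hγt₀ : γ t₀ = (t₀, y₀) := by simp [hγ, hx₀, smul_smul, inv_mul_cancel₀ ht₀]
      have hx₀A : x₀ ∈ A₀ := hmem
      have hγX : ∀ t, t ≠ 0 → γ t ∈ X₀ := fun t ht => by
        change b + t • (t⁻¹ • (x₀ - b)) ∈ A₀
        rwa [smul_smul, mul_inv_cancel₀ ht, one_smul, add_sub_cancel]
      have hγd : HasDerivAt γ ((1 : ℂ), -(t₀⁻¹ ^ 2) • (x₀ - b)) t₀ := by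
        refine (hasDerivAt_id t₀).prodMk ?_
        have h1 : HasDerivAt (fun t : ℂ => t⁻¹) (-(t₀ ^ 2)⁻¹) t₀ := hasDerivAt_inv ht₀
        have h2 := h1.smul_const (x₀ - b)
        convert h2 using 1
        rw [inv_pow]
      -- `g ∘ γ = 0` near `t₀`
      have hev : ∀ᶠ t in 𝓝 t₀, g (γ t) = 0 := by
        have hγc : ContinuousAt γ t₀ := hγd.continuousAt
        have h1 : ∀ᶠ t in 𝓝 t₀, γ t ∈ U := hγc.preimage_mem_nhds (by rw [hγt₀]; exact hU.mem_nhds hzU)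
        have h2 : ∀ᶠ t in 𝓝 t₀, t ≠ 0 := isOpen_ne.mem_nhds ht₀
        filter_upwards [h1, h2] with t ht1 ht2
        have : γ t ∈ X₀ ∩ U := ⟨hγX t ht2, ht1⟩
        rw [hXU] at this
        exact this.2
      have hgdγ : DifferentiableAt ℂ g (γ t₀) := by rw [hγt₀]; exact hgd
      have hderiv : HasDerivAt (g ∘ γ) (fderiv ℂ g (γ t₀) ((1 : ℂ), -(t₀⁻¹ ^ 2) • (x₀ - b))) t₀ :=
        hgdγ.hasFDerivAt.comp_hasDerivAt t₀ hγd
      rw [hγt₀] at hderiv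
      have hzero : HasDerivAt (g ∘ γ) 0 t₀ :=
        (hasDerivAt_const t₀ (0 : Fin c → ℂ)).congr_of_eventuallyEq
          (hev.mono fun t ht => by simp [Function.comp_apply, ht])
      have heq := hderiv.unique hzero
      have hvec : -(t₀⁻¹ ^ 2) • (x₀ - b) = -(t₀⁻¹ • y₀) := by
        simp [hx₀, smul_smul, pow_two, mul_assoc, inv_mul_cancel₀ ht₀]
      rwa [hvec] at heq
    -- hence `L` is onto already on `{0} × V`, i.e. `L ∘ Dθ` is onto
    intro w
    obtain ⟨⟨τ, v⟩, huw⟩ := hsurj w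
    refine ⟨t₀ • (v + τ • t₀⁻¹ • y₀), ?_⟩
    have hsplit : ((τ : ℂ), v) = τ • ((1 : ℂ), -(t₀⁻¹ • y₀)) + ((0 : ℂ), v + τ • t₀⁻¹ • y₀) := by
      ext <;> simp [smul_neg]
    rw [ContinuousLinearMap.comp_apply, ContinuousLinearMap.prod_apply, zero_apply,
      smul_apply, ContinuousLinearMap.id_apply, smul_smul, inv_mul_cancel₀ ht₀,
      one_smul, ← huw, hsplit, map_add, map_smul, hkill, smul_zero, zero_add]

/-- **Regular points of the deformation space off `H` have codimension `≥ dim V − p`** when `A`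
has pure dimension `p`. [cite: Chirka1989, §8.1] -/
theorem le_codim_deformationSpace {p : ℕ} (hA : HasPureDim 𝓘(ℂ, V) A p)
    {z : deformationDomain Ω b} (hz : z ∈ regularLocus 𝓘(ℂ, ℂ × V) (deformationSpace A b))
    (hzH : z ∉ deformationHyp Ω b) {c : ℕ}
    (hc : IsRegularPointOfCodim 𝓘(ℂ, ℂ × V) (deformationSpace A b) c z) :
    Module.finrank ℂ V - p ≤ c := by
  have h1 : IsRegPt (((↑) : deformationDomain Ω b → ℂ × V) '' deformationSpace A b) c (z : ℂ × V) := by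
    have := hc.isRegPt_chartImage (x := z) (by rw [Opens.extChartAt_source]; trivial)
    rwa [Opens.chartImage_eq, Opens.extChartAt_apply] at this
  have hz1 : (z : ℂ × V) = (z.1.1, z.1.2) := rfl
  rw [hz1] at h1
  rw [mem_deformationHyp] at hzH
  have hmem : (z.1.1, z.1.2) ∈ ((↑) : deformationDomain Ω b → ℂ × V) '' deformationSpace A b :=
    ⟨z, hz.1, rfl⟩
  have h2 := isRegPt_of_isRegPt_image_deformationSpace hzH hmem h1
  have hx : b + z.1.1 • z.1.2 ∈ regLocus (((↑) : Ω → V) '' A) := by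
    refine ⟨?_, c, h2⟩
    have := hmem
    rw [image_coe_deformationSpace] at this
    exact this
  have := hA.finrank_le_of_isRegPt_image_coe hx h2
  omega

end Codim

/-! ### The limit cone has dimension `≤ p` -/

section LimitConeDim

variable [FiniteDimensional ℂ V] {Ω : Opens V} {b : V} {A : Set Ω}

omit [FiniteDimensional ℂ V] in
/-- The image in `ℂ × V` of `cl (X ∖ H) ∩ H` is `{0} × F`. [folklore] -/
theorem image_coe_deformationClosure_inter_hyp (A : Set Ω) (hb : b ∈ (Ω : Set V)) :
    ((↑) : deformationDomain Ω b → ℂ × V) '' (deformationClosure A b ∩ deformationHyp Ω b) =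
      {z : ℂ × V | z.1 = 0 ∧ z.2 ∈ limitCone A hb} := by
  ext z
  constructor
  · rintro ⟨w, ⟨hwD, hwH⟩, rfl⟩
    rw [mem_deformationHyp] at hwH
    refine ⟨hwH, ?_⟩
    rw [mem_limitCone]
    convert hwD using 1
    apply Subtype.ext
    change ((0 : ℂ), (w : ℂ × V).2) = (w : ℂ × V)
    ext
    · exact hwH.symm
    · rfl
  · rintro ⟨hz1, hz2⟩
    rw [mem_limitCone] at hz2
    refine ⟨centralEmbed hb z.2, ⟨hz2, by simp [mem_deformationHyp]⟩, ?_⟩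
    change ((0 : ℂ), z.2) = z
    ext
    · exact hz1.symm
    · rfl

omit [FiniteDimensional ℂ V] in
/-- `Fin.cons a f = 0 ↔ a = 0 ∧ f = 0`. [folklore] -/
theorem cons_eq_zero_iff {n : ℕ} {a : ℂ} {f : Fin n → ℂ} :
    (Fin.cons a f : Fin (n + 1) → ℂ) = 0 ↔ a = 0 ∧ f = 0 := by
  have h0 : (0 : Fin (n + 1) → ℂ) = Fin.cons 0 0 := by
    funext i
    refine Fin.cases ?_ (fun j => ?_) i <;> simp
  rw [h0, Fin.cons_inj]

omit [FiniteDimensional ℂ V] in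
/-- **`{0} × F` is regular of codimension `c + 1` where `F` is regular of codimension `c`.**
[folklore] -/
theorem isRegPt_zero_prod {F : Set V} {c : ℕ} {y : V} (h : IsRegPt F c y) :
    IsRegPt {z : ℂ × V | z.1 = 0 ∧ z.2 ∈ F} (c + 1) ((0 : ℂ), y) := by
  obtain ⟨U, hU, hyU, g, hg, hFU, hsurj⟩ := h
  -- the defining map `(t, x) ↦ (t, g x)`
  set G : ℂ × V → (Fin (c + 1) → ℂ) := fun z => Fin.cons z.1 (g z.2) with hG
  have hGc : ∀ i, DifferentiableOn ℂ (fun z : ℂ × V => G z i) (Prod.snd ⁻¹' U) := by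
    intro i
    refine Fin.cases ?_ (fun j => ?_) i
    · simp only [hG, Fin.cons_zero]
      exact differentiableOn_fst
    · simp only [hG, Fin.cons_succ]
      exact ((differentiableOn_pi.1 hg j).comp differentiableOn_snd (mapsTo_preimage _ _))
  have hGd : DifferentiableOn ℂ G (Prod.snd ⁻¹' U) := differentiableOn_pi.2 hGc
  refine ⟨Prod.snd ⁻¹' U, hU.preimage continuous_snd, hyU, G, hGd, ?_, ?_⟩
  · ext z
    simp only [mem_inter_iff, mem_setOf_eq, mem_preimage, mem_singleton_iff, hG]
    constructor
    · rintro ⟨⟨hz1, hz2⟩, hzU⟩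
      have : z.2 ∈ F ∩ U := ⟨hz2, hzU⟩
      rw [hFU] at this
      refine ⟨hzU, ?_⟩
      rw [cons_eq_zero_iff]
      exact ⟨hz1, this.2⟩
    · rintro ⟨hzU, hz0⟩
      rw [cons_eq_zero_iff] at hz0
      have : z.2 ∈ U ∩ g ⁻¹' {0} := ⟨hzU, hz0.2⟩
      rw [← hFU] at this
      exact ⟨⟨hz0.1, this.1⟩, hzU⟩
  · -- the differential `(τ, v) ↦ (τ, Dg(y) v)` is onto
    have hgd : DifferentiableAt ℂ g y := hg.differentiableAt (hU.mem_nhds hyU)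
    have hGderiv : HasFDerivAt G
        (ContinuousLinearMap.pi (Fin.cons (ContinuousLinearMap.fst ℂ ℂ V)
          (fun j => (ContinuousLinearMap.proj j).comp ((fderiv ℂ g y).comp
            (ContinuousLinearMap.snd ℂ ℂ V))))) ((0 : ℂ), y) := by
      rw [hasFDerivAt_pi']
      intro i
      refine Fin.cases ?_ (fun j => ?_) i
      · simp only [hG, Fin.cons_zero, ContinuousLinearMap.proj_pi]
        exact hasFDerivAt_fst
      · simp only [hG, Fin.cons_succ, ContinuousLinearMap.proj_pi]
        have h1 : HasFDerivAt (fun z : ℂ × V => g z.2) ((fderiv ℂ g y).comp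
            (ContinuousLinearMap.snd ℂ ℂ V)) ((0 : ℂ), y) :=
          hgd.hasFDerivAt.comp ((0 : ℂ), y) hasFDerivAt_snd
        exact (hasFDerivAt_pi'.1 h1) j
    rw [hGderiv.fderiv]
    intro w
    obtain ⟨v, hv⟩ := hsurj (Fin.tail w)
    refine ⟨(w 0, v), ?_⟩
    ext i
    refine Fin.cases ?_ (fun j => ?_) i
    · simp
    · simp only [ContinuousLinearMap.pi_apply, Fin.cons_succ, ContinuousLinearMap.coe_comp,
        Function.comp_apply, ContinuousLinearMap.proj_apply]
      change fderiv ℂ g y v j = w j.succ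
      rw [hv]
      rfl

/-- **The limit cone of a pure `p`-dimensional analytic set has dimension `≤ p`**: every regular
point of `F = limitCone A hb` has codimension `≥ dim V − p` in `V`. The regular points of `X ∖ H`
have codimension `≥ dim V − p` in `G` (`le_codim_deformationSpace`), hence those of
`cl (X ∖ H) ∩ H = {0} × F` have codimension `≥ dim V − p + 1`
(`IsAnalyticSet.succ_le_codim_closure_diff_inter`), while `{0} × F` is regular of codimension
`c + 1` at `(0, y)` when `F` is regular of codimension `c` at `y`. [cite: Chirka1989, §8.3 Lemma 1] -/
theorem le_codim_limitCone {p : ℕ} (hA : HasPureDim 𝓘(ℂ, V) A p) (hb : b ∈ (Ω : Set V)) {y : V}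
    (hy : y ∈ limitCone A hb) {c : ℕ} (hc : IsRegularPointOfCodim 𝓘(ℂ, V) (limitCone A hb) c y) :
    Module.finrank ℂ V - p ≤ c := by
  haveI : LocallyCompactSpace (deformationDomain Ω b) := (deformationDomain Ω b).isOpen.locallyCompactSpace
  -- regularity of `{0} × F` at `(0, y)`, of codimension `c + 1`
  have hc' : IsRegPt (limitCone A hb) c y := isRegularPointOfCodim_iff_isRegPt.1 hc
  have hprod := isRegPt_zero_prod hc'
  rw [← image_coe_deformationClosure_inter_hyp A hb] at hprod
  have hreg : IsRegularPointOfCodim 𝓘(ℂ, ℂ × V) (deformationClosure A b ∩ deformationHyp Ω b) (c + 1)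
      (centralEmbed hb y) := by
    refine isRegularPointOfCodim_of_isRegPt_chartImage (I := 𝓘(ℂ, ℂ × V)) (x := centralEmbed hb y)
      (by rw [Opens.extChartAt_source]; trivial) ?_
    rw [Opens.chartImage_eq, Opens.extChartAt_apply]
    exact hprod
  have hmem : centralEmbed hb y ∈ deformationClosure A b ∩ deformationHyp Ω b :=
    ⟨hy, by simp [mem_deformationHyp]⟩
  have hbound := (isAnalyticSet_deformationSpace hA.isAnalyticSet b).succ_le_codim_closure_diff_inter
    (isAnalyticSet_deformationHyp Ω b) (c₀ := Module.finrank ℂ V - p)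
    (fun z hz hzH c' hc'' => le_codim_deformationSpace hA hz hzH hc'') hmem hreg
  omega

/-- Model-space form: every regular point of the limit cone has codimension `q` with
`dim V ≤ q + p` ("`dim F ≤ p`"). [cite: Chirka1989, §8.3 Lemma 1] -/
theorem finrank_le_of_isRegPt_limitCone {p : ℕ} (hA : HasPureDim 𝓘(ℂ, V) A p) (hb : b ∈ (Ω : Set V))
    {y : V} (hy : y ∈ limitCone A hb) {q : ℕ} (hq : IsRegPt (limitCone A hb) q y) :
    Module.finrank ℂ V ≤ q + p := by
  have := le_codim_limitCone hA hb hy (isRegularPointOfCodim_iff_isRegPt.2 hq)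
  omega

end LimitConeDim

end Literature.Geometry.Kaehler
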